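import Literature.Topology.FourManifolds.TrisectionsHandlebodyH23Charts
import Literature.Topology.FourManifolds.SublevelOneHandlebody
import HarnessLib

/-!
# Assembly of the trisection from a handle decomposition: reduction to seven handle
# decompositions (Gay–Kirby 2016, Lemma 14)

Topic `Literature/Topology/FourManifolds`; for the fact seat
`provefact-Literature.Topology.FourManifolds.exists_isBalancedGKTrisection` (Gay–Kirby 2016,
Thm. 4 via Lemma 14).  Everything in this file is **proved**; no named facts are introduced.

The geometric part of Gay–Kirby's Lemma 14 being complete (`TrisectionsAssembly.lean`,
`TrisectionsHandlebodies.lean`, `TrisectionsHandlebodyH23Charts.lean`: the three sectors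
`X₁, X₂, X₃` of `TriData` with their straightened structures, the three pairwise intersections
`H₁₂ ≅ {g ≤ b}`, `H₃₁ ≅ {b ≤ g}`, `H₂₃` with their smooth embeddings, images and boundaries),
this file states the assembly theorem with the remaining inputs in their final, purely
Morse-theoretic form — **seven handle decompositions**:

* `connectedSpace_of_hasHandleDecomposition_handleCount_one` — a compact manifold with boundary
  carrying a handle decomposition with one `0`-handle and otherwise only `1`-handles is connected
  (the tree's `IsMorseAdapted.connectedSpace_of_counts`, Milnor 1965, Thm. 3.14), so that the
  connectedness clauses of `IsGKTrisection` need no separate hypothesis;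
* `exists_H₁₂'`, `exists_H₃₁'` — clause (iii) for the pairs `(X₁, X₂)`, `(X₃, X₁)` from the
  handle decompositions of the sublevel set `{g ≤ b}` (`RegularSublevel B.hg`) and the
  superlevel set `{b ≤ g}` (`RegularSuperlevel B.hg`) of the Heegaard function on `∂X₁⁰` — the
  form produced by `TubeSystem.exists_heegaardFunction` (`TrisectionsHeegaardSplitting.lean`);
* `clause_iii'` — clause (iii) from its three instances;
* **`isGKTrisection_of_handles`** — `IsGKTrisection X gen ![k₁, k₂, k₃] T.sectors` from the
  side conditions `hc2`, `hη`, `hL` of the construction and: handle decompositions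
  `handleCount 1 kᵢ` of the three straightened sectors, and `handleCount 1 gen` of `{g ≤ b}`,
  `{b ≤ g}` and `H₂₃` (Gay–Kirby: "`X₁` and `X₃` are `♮ᵏ S¹ × B³`", "the `2`-handles cancel
  `g - k` of the `S¹ × B³`'s", "`H₂₃ = F × [-ε, ε] ∪ 2`-handles is a handlebody").

## References

* D. Gay, R. Kirby, *Trisecting 4-manifolds*, Geom. Topol. 20 (2016) 3097–3132
  (arXiv:1205.1565): Def. 1; §4, Lemma 14 and its proof; Thm. 4. [GayKirby2016]
* J. Milnor, *Lectures on the h-cobordism theorem* (1965), Thm. 3.14 and Thm. 8.1.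
  [MilnorHCobordism1965]
-/

open scoped Manifold ContDiff Topology
open Set Function Filter

noncomputable section

universe u

namespace Literature.Topology.FourManifolds

/-! ### One `0`-handle and `1`-handles only: connected -/

section Connected

variable {n : ℕ} {W : Type u} [TopologicalSpace W] [T2Space W] [SecondCountableTopology W]
  [CompactSpace W] [ChartedSpace (EuclideanHalfSpace (n + 1)) W] [IsManifold (𝓡∂ (n + 1)) ∞ W]

/-- **A handle decomposition with one `0`-handle and otherwise only `1`-handles lives on a
connected manifold.** [cite: MilnorHCobordism1965, Thm. 3.14] -/
theorem connectedSpace_of_hasHandleDecomposition_handleCount_one {k : ℕ}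
    (h : HasHandleDecomposition n W (handleCount 1 k)) : ConnectedSpace W := by
  obtain ⟨f, hf, hc⟩ := h
  refine hf.connectedSpace_of_counts (by rw [hc]; rfl) fun j hj => ?_
  rw [hc]
  have h0 : j ≠ 0 := by omega
  have h1 : j ≠ 1 := by omega
  simp [handleCount, h0, h1]

end Connected

variable {X : Type u} [TopologicalSpace X] [T2Space X] [CompactSpace X]
  [ChartedSpace (EuclideanSpace ℝ (Fin 4)) X] [IsManifold (𝓡 4) ∞ X]

namespace BiCollar

namespace TriData

variable {B : BiCollar X} (T : B.TriData)

/-! ### Clause (iii) for `(X₁, X₂)` and `(X₃, X₁)` from the handle decompositions of `{g ≤ b}`, `{b ≤ g}` -/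

/-- **Clause (iii) for the pair `(X₁, X₂)`** from the connectedness and the handle
decomposition of the sublevel set `{g ≤ b}` of the Heegaard function: `H₁₂` is its image under
the graph embedding over the bevel (`graphMap`). [cite: GayKirby2016, Def. 1 and §4, Lemma 14] -/
theorem exists_H₁₂' (hc2 : B.a + B.U.δ + 2 * T.ε ≤ T.c) {gen : ℕ}
    (hH : ConnectedSpace (RegularSublevel B.hg) ∧ HasHandleDecomposition 2 (RegularSublevel B.hg) (handleCount 1 gen)) :
    T.ClauseIII gen 0 1 :=
  ⟨RegularSublevel B.hg, inferInstance, inferInstance, graphMap T.τH B.hg, inferInstance, inferInstance, hH.1, hH.2,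
    isSmoothEmbedding_graphMap T.τH B.hg, T.range_graphMap₁₂ hc2,
    by rw [T.image_boundary_graphMap₁₂, ← T.iInter_sectors hc2]⟩

/-- **Clause (iii) for the pair `(X₃, X₁)`** from the connectedness and the handle
decomposition of the superlevel set `{b ≤ g}` of the Heegaard function. [cite: GayKirby2016, Def. 1 and §4, Lemma 14] -/
theorem exists_H₃₁' (hc2 : B.a + B.U.δ + 2 * T.ε ≤ T.c) {gen : ℕ}
    (hH : ConnectedSpace (RegularSuperlevel B.hg) ∧
      HasHandleDecomposition 2 (RegularSuperlevel B.hg) (handleCount 1 gen)) :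
    T.ClauseIII gen 2 0 :=
  ⟨RegularSuperlevel B.hg, inferInstance, inferInstance, graphMap T.τH.neg B.hg.const_sub, inferInstance,
    inferInstance, hH.1, hH.2, isSmoothEmbedding_graphMap T.τH.neg B.hg.const_sub, T.range_graphMap₃₁ hc2,
    by rw [T.image_boundary_graphMap₃₁, ← T.iInter_sectors hc2]⟩

/-- **Clause (iii) from its three instances** (symmetry in the pair). [cite: GayKirby2016, Def. 1] -/
theorem clause_iii' {gen : ℕ} (h01 : T.ClauseIII gen 0 1) (h20 : T.ClauseIII gen 2 0) (h12 : T.ClauseIII gen 1 2) :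
    ∀ i j : Fin 3, i ≠ j → T.ClauseIII gen i j := by
  intro i j hij
  fin_cases i <;> fin_cases j
  · exact absurd rfl hij
  · exact h01
  · exact T.clauseIII_symm h20
  · exact T.clauseIII_symm h01
  · exact absurd rfl hij
  · exact h12
  · exact h20
  · exact T.clauseIII_symm h12
  · exact absurd rfl hij

/-! ### The assembly theorem: seven handle decompositions -/

section Handles

variable [SecondCountableTopology X]
  (hc2 : B.a + B.U.δ + 2 * T.ε ≤ T.c) {η : ℝ} (hη : 2 * T.ε ≤ η)
  (hL : ∀ q : X, IsMCriticalPt (𝓡 4) B.f q → B.a < B.f q → B.f q ≤ T.c →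
    ∀ y : B.Y, RegularLevel.incl B.hf y ∈ stableSet (𝓡 4) B.U.ξ q → B.g y < B.b - η)

include hc2 hη hL in
/-- **The sectors of the construction form a Gay–Kirby trisection as soon as the seven pieces
have the right handle decompositions**: `handleCount 1 kᵢ` on the straightened sectors
`X₁, X₂, X₃` (clause (ii)), and `handleCount 1 gen` on `{g ≤ b} ≅ H₁₂`, `{b ≤ g} ≅ H₃₁` and
`H₂₃` (clause (iii)); connectedness follows (`connectedSpace_of_hasHandleDecomposition_handleCount_one`).
[cite: GayKirby2016, Def. 1; §4, Lemma 14 and its proof; Thm. 4] -/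
theorem isGKTrisection_of_handles {gen k₁ k₂ k₃ : ℕ}
    (h₁ : letI := T.D.cornerSliceAtlas.chartedSpace
      HasHandleDecomposition 3 T.D.sector (handleCount 1 k₁))
    (h₂ : letI := (T.cornerSliceAtlas₂ hc2 hη hL).chartedSpace
      HasHandleDecomposition 3 T.X₂ (handleCount 1 k₂))
    (h₃ : letI := (T.cornerSliceAtlas₃ hc2 hη hL).chartedSpace
      HasHandleDecomposition 3 T.X₃ (handleCount 1 k₃))
    (hH₁₂ : HasHandleDecomposition 2 (RegularSublevel B.hg) (handleCount 1 gen))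
    (hH₃₁ : HasHandleDecomposition 2 (RegularSuperlevel B.hg) (handleCount 1 gen))
    (hH₂₃ : letI := (T.bsliceAtlas hc2 hη hL).chartedSpace
      HasHandleDecomposition 2 T.H₂₃ (handleCount 1 gen)) :
    IsGKTrisection X gen ![k₁, k₂, k₃] T.sectors := by
  -- connectedness of the seven pieces
  have hc₁ : letI := T.D.cornerSliceAtlas.chartedSpace; ConnectedSpace T.D.sector := by
    letI := T.D.cornerSliceAtlas.chartedSpace
    haveI := T.D.cornerSliceAtlas.isManifold
    haveI := T.D.compactSpace_sector
    exact connectedSpace_of_hasHandleDecomposition_handleCount_one h₁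
  have hc₂ : letI := (T.cornerSliceAtlas₂ hc2 hη hL).chartedSpace; ConnectedSpace T.X₂ := by
    letI := (T.cornerSliceAtlas₂ hc2 hη hL).chartedSpace
    haveI := (T.cornerSliceAtlas₂ hc2 hη hL).isManifold
    haveI := T.compactSpace_X₂
    exact connectedSpace_of_hasHandleDecomposition_handleCount_one h₂
  have hc₃ : letI := (T.cornerSliceAtlas₃ hc2 hη hL).chartedSpace; ConnectedSpace T.X₃ := by
    letI := (T.cornerSliceAtlas₃ hc2 hη hL).chartedSpace
    haveI := (T.cornerSliceAtlas₃ hc2 hη hL).isManifold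
    haveI := T.compactSpace_X₃
    exact connectedSpace_of_hasHandleDecomposition_handleCount_one h₃
  have hc₁₂ : ConnectedSpace (RegularSublevel B.hg) := connectedSpace_of_hasHandleDecomposition_handleCount_one hH₁₂
  have hc₃₁ : ConnectedSpace (RegularSuperlevel B.hg) := connectedSpace_of_hasHandleDecomposition_handleCount_one hH₃₁
  have hc₂₃ : letI := (T.bsliceAtlas hc2 hη hL).chartedSpace; ConnectedSpace T.H₂₃ := by
    letI := (T.bsliceAtlas hc2 hη hL).chartedSpace
    haveI := (T.bsliceAtlas hc2 hη hL).isManifold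
    haveI := T.compactSpace_H₂₃
    exact connectedSpace_of_hasHandleDecomposition_handleCount_one hH₂₃
  refine ⟨T.iUnion_sectors, fun i => ?_,
    T.clause_iii' (T.exists_H₁₂' hc2 ⟨hc₁₂, hH₁₂⟩) (T.exists_H₃₁' hc2 ⟨hc₃₁, hH₃₁⟩)
      (T.exists_H₂₃ hc2 hη hL ⟨hc₂₃, hH₂₃⟩)⟩
  fin_cases i
  · exact T.clause_ii_X₁ hc2 ⟨hc₁, h₁⟩
  · exact T.clause_ii_X₂ hc2 hη hL ⟨hc₂, h₂⟩
  · exact T.clause_ii_X₃ hc2 hη hL ⟨hc₃, h₃⟩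

end Handles

end TriData

end BiCollar

end Literature.Topology.FourManifolds

end
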